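import Summits.CriticalPhenomena.SAWScalingLimit.Theorems.SAWDevelopingMapHexTransferGMHexDictionaryWalks

/-!
# The `π/3` dictionary, part II: honeycomb paths ARE Yang–Baxter walks of nonzero weight

Helper file of the line `yb-relay` for the crux `HexTransfer` (stmt-CriticalPhenomena-14221), stub
`stub_gmHexDictionary`, continuing `…GMHexDictionaryWalks`: the inverse of the encoding
`γ ↦ hvInner γ` of `YangBaxterSAWHexBridges.lean` between boundary edges `a ≠ b` of a face set `Δ`.

* `mem_pairEdges`, `nodup_pairEdges`, `IsBdryEdge.not_mem_pairEdges` — the sides crossed along a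
  self-avoiding honeycomb path are distinct, and a boundary edge is never crossed;
* `noncross_of_nodup_listTris` — a mid-edge list whose triangle list is self-avoiding carries no two
  crossing straight arcs;
* `IsTriPath Δ a b S` (hypothesis structure) and **`decodeWalk`**: the Yang–Baxter walk
  `a :: pairEdges S ++ [b]` of a self-avoiding honeycomb path `S` from the triangle resting on `a` to
  the one resting on `b` through triangles of rhombi of `Δ`; `hvInner_decodeWalk : hvInner = S`.

[cite: GlazmanManolescu2019, §1 p. 3 ("the model becomes that on the hexagonal lattice"), Fig. 2];
elementary statements tagged [folklore].
-/

namespace Summit.CriticalPhenomena.SAWScalingLimit.Cruxes.HexTransfer.YbRelay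

open Literature.Probability.RandomPlanarGeometry
open Literature.Probability.RandomPlanarGeometry.SAW
open Literature.Probability.RandomPlanarGeometry.SAW.YangBaxter

/-! ### The sides crossed along a honeycomb path -/

/-- A crossed side is crossed between two triangles of the path. [folklore] -/
theorem mem_pairEdges : ∀ (L : List HV) {e : MidEdge}, e ∈ YBWalk.pairEdges L →
    ∃ p ∈ L, ∃ q ∈ L, edgeOf p q = some e
  | [], e, h => by simp [YBWalk.pairEdges] at h
  | [v], e, h => by simp at h
  | v :: w :: l, e, h => by
    rw [pairEdges_cons_cons, List.mem_append, Option.mem_toList] at h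
    rcases h with h | h
    · exact ⟨v, by simp, w, by simp, h⟩
    · obtain ⟨p, hp, q, hq, hpq⟩ := mem_pairEdges (w :: l) h
      exact ⟨p, List.mem_cons_of_mem _ hp, q, List.mem_cons_of_mem _ hq, hpq⟩

/-- **The side crossed between two triangles is a common side of their (different) rhombi, resting
on both.** [cite: GlazmanManolescu2019, §1, Fig. 2] -/
theorem edgeOf_eq_some {v w : HV} {e : MidEdge} (h : edgeOf v w = some e) :
    ∃ (g : Face) (s : Side) (g' : Face) (s' : Side),
      g.side s = e ∧ g'.side s' = e ∧ g ≠ g' ∧ g.hv s = v ∧ g'.hv s' = w := by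
  obtain ⟨x, y, c⟩ := v
  obtain ⟨x', y', c'⟩ := w
  unfold edgeOf at h
  dsimp only at h
  split_ifs at h with h1 h2 h3 h4 <;> rw [Option.some.injEq] at h <;> subst h
  · obtain ⟨hc, hc', hx, hy⟩ := h1
    subst hc hc'
    refine ⟨(y, -x), .E, (y', -x'), .W, ?_, ?_, ?_, ?_, ?_⟩ <;>
      simp [Face.side, Face.hv, Side.tri] <;> omega
  · obtain ⟨hc, hc', hx, hy⟩ := h2
    subst hc hc'
    refine ⟨(y, -x), .W, (y', -x'), .E, ?_, ?_, ?_, ?_, ?_⟩ <;>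
      simp [Face.side, Face.hv, Side.tri] <;> omega
  · obtain ⟨hc, hc', hx, hy⟩ := h3
    subst hc hc'
    refine ⟨(y, -x), .N, (y', -x'), .S, ?_, ?_, ?_, ?_, ?_⟩ <;>
      simp [Face.side, Face.hv, Side.tri] <;> omega
  · obtain ⟨hc, hc', hx, hy⟩ := h4
    subst hc hc'
    refine ⟨(y, -x), .S, (y', -x'), .N, ?_, ?_, ?_, ?_, ?_⟩ <;>
      simp [Face.side, Face.hv, Side.tri] <;> omega

/-- A mid-edge has exactly two incidences `(rhombus, side)`. [folklore] -/
theorem incidence_two {e : MidEdge} {g g' g'' : Face} {s s' s'' : Side} (hg : g.side s = e)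
    (hg' : g'.side s' = e) (hne : g ≠ g') (hg'' : g''.side s'' = e) :
    (g'' = g ∧ s'' = s) ∨ (g'' = g' ∧ s'' = s') := by
  by_cases h : g'' = g'
  · subst h
    exact Or.inr ⟨rfl, Face.side_injective _ (hg''.trans hg'.symm)⟩
  · exact Or.inl (incidence_unique (hg.trans hg'.symm) hne (hg''.trans hg'.symm) h)

/-- A side is crossed only between its two triangles. [folklore] -/
theorem eq_of_edgeOf_eq_edgeOf {p q v w : HV} {e : MidEdge} (h : edgeOf p q = some e)
    (h' : edgeOf v w = some e) : v = p ∨ v = q := by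
  obtain ⟨g, s, g', s', hg, hg', hne, rfl, rfl⟩ := edgeOf_eq_some h
  obtain ⟨g₂, s₂, -, -, hg₂, -, -, rfl, -⟩ := edgeOf_eq_some h'
  rcases incidence_two hg hg' hne hg₂ with ⟨rfl, rfl⟩ | ⟨rfl, rfl⟩
  · exact Or.inl rfl
  · exact Or.inr rfl

/-- **Along a self-avoiding honeycomb path no side is crossed twice.** [folklore] -/
theorem nodup_pairEdges : ∀ (L : List HV), L.Nodup → (YBWalk.pairEdges L).Nodup
  | [], _ => List.nodup_nil
  | [v], _ => by simp
  | v :: w :: l, h => by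
    rw [List.nodup_cons] at h
    rw [pairEdges_cons_cons]
    refine List.Nodup.append ?_ (nodup_pairEdges (w :: l) h.2) fun e he he' => ?_
    · cases edgeOf v w <;> simp
    · rw [Option.mem_toList] at he
      obtain ⟨p, hp, q, hq, hpq⟩ := mem_pairEdges (w :: l) he'
      rcases eq_of_edgeOf_eq_edgeOf hpq he with rfl | rfl
      · exact h.1 hp
      · exact h.1 hq

/-- **A boundary edge of `Δ` is never crossed by a path through rhombi of `Δ`.** [folklore] -/
theorem IsBdryEdge.not_mem_pairEdges {Δ : Set Face} {e : MidEdge} (he : IsBdryEdge Δ e) {L : List HV}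
    (hL : ∀ v ∈ L, faceHV v ∈ Δ) : e ∉ YBWalk.pairEdges L := by
  intro h
  obtain ⟨p, hp, q, hq, hpq⟩ := mem_pairEdges L h
  obtain ⟨g, s, g', s', hg, hg', hne, rfl, rfl⟩ := edgeOf_eq_some hpq
  have h1 := hL _ hp
  have h2 := hL _ hq
  rw [faceHV_hv] at h1 h2
  exact hne (he.face_unique hg' h2 hg h1)

/-! ### No crossing and nonzero weight from a self-avoiding triangle list -/

/-- Disjointness of the triangle lists of two different arcs of a list with self-avoiding triangle
list. [folklore] -/
theorem pairwise_disjoint_arcTris_of_nodup {M : List MidEdge} (hnd : (listTris M).Nodup) :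
    (arcsOf M).Pairwise fun p q => List.Disjoint (arcTris p) (arcTris q) := by
  rw [listTris, List.nodup_flatMap] at hnd
  exact hnd.2

/-- Disjointness is symmetric (instance for `List.Pairwise.forall`). [folklore] -/
instance : Std.Symm (fun p q : MidEdge × MidEdge => List.Disjoint (arcTris p) (arcTris q)) :=
  ⟨fun _ _ h => h.symm⟩

/-- Two different arcs of a list with self-avoiding triangle list cross disjoint sets of triangles.
[folklore] -/
theorem disjoint_arcTris_of_nodup {M : List MidEdge} (hnd : (listTris M).Nodup) {p q : MidEdge × MidEdge}
    (hp : p ∈ arcsOf M) (hq : q ∈ arcsOf M) (hpq : p ≠ q) : List.Disjoint (arcTris p) (arcTris q) :=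
  (pairwise_disjoint_arcTris_of_nodup hnd).forall hp hq hpq

/-- **A mid-edge list with self-avoiding triangle list has no two crossing straight arcs** (each
straight arc crosses both triangles of its rhombus). [folklore] -/
theorem noncross_of_nodup_listTris {M : List MidEdge} (hnd : (listTris M).Nodup) (f : Face) :
    ((f.side .W, f.side .E) ∈ arcsOf M ∨ (f.side .E, f.side .W) ∈ arcsOf M) →
      ¬((f.side .S, f.side .N) ∈ arcsOf M ∨ (f.side .N, f.side .S) ∈ arcsOf M) := by
  intro h1 h2
  have key : ∀ {s t s' t' : Side} (hst : s ≠ t) (hst' : s' ≠ t') (hss : s ≠ s') (h1 : s.tri ≠ t.tri)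
      (h2 : s'.tri ≠ t'.tri), (f.side s, f.side t) ∈ arcsOf M → (f.side s', f.side t') ∈ arcsOf M → False := by
    intro s t s' t' hst hst' hss h1 h2 hm hm'
    have hne : (f.side s, f.side t) ≠ (f.side s', f.side t') := fun h =>
      hss (Face.side_injective f (Prod.mk.inj h).1)
    have hd := disjoint_arcTris_of_nodup hnd hm hm' hne
    obtain ⟨e1, e2, e3⟩ := faceOf_side_side f hst
    obtain ⟨e1', e2', e3'⟩ := faceOf_side_side f hst'
    have m1 : f.hv .W ∈ arcTris (f.side s, f.side t) := by
      have := mem_arcTris_of_tri_ne (p := (f.side s, f.side t)) (by rw [e2, e3]; exact h1) .W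
      rwa [e1] at this
    have m2 : f.hv .W ∈ arcTris (f.side s', f.side t') := by
      have := mem_arcTris_of_tri_ne (p := (f.side s', f.side t')) (by rw [e2', e3']; exact h2) .W
      rwa [e1'] at this
    exact hd m1 m2
  rcases h1 with h1 | h1 <;> rcases h2 with h2 | h2
  · exact key (by decide) (by decide) (by decide) (by decide) (by decide) h1 h2
  · exact key (by decide) (by decide) (by decide) (by decide) (by decide) h1 h2
  · exact key (by decide) (by decide) (by decide) (by decide) (by decide) h1 h2
  · exact key (by decide) (by decide) (by decide) (by decide) (by decide) h1 h2

/-- A `filterMap` through a guarded function is a `map` of a `filter`. [folklore] -/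
theorem filterMap_eq_map_filter_of {α β : Type*} (l : List α) (g : α → Option β) (P : α → Prop)
    [DecidablePred P] (k : α → β) (h1 : ∀ p ∈ l, P p → g p = some (k p))
    (h2 : ∀ p ∈ l, ¬P p → g p = none) : l.filterMap g = (l.filter P).map k := by
  induction l with
  | nil => rfl
  | cons p l ih =>
    have ih' := ih (fun q hq => h1 q (List.mem_cons_of_mem _ hq)) (fun q hq => h2 q (List.mem_cons_of_mem _ hq))
    by_cases hp : P p
    · rw [List.filterMap_cons_some (h1 p List.mem_cons_self hp), List.filter_cons_of_pos (by simpa using hp),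
        List.map_cons, ih']
    · rw [List.filterMap_cons_none (h2 p List.mem_cons_self hp), List.filter_cons_of_neg (by simpa using hp), ih']

/-- The kind of an arc through its end-sides. [folklore] -/
theorem arcKindOf_eq_some {p : MidEdge × MidEdge} {f : Face} (h : arcFace p = some f) :
    arcKindOf p = some (arcKind (sideIn p) (sideOut p)) := by
  obtain ⟨s, t, -, hs, ht, hk⟩ := exists_sides_of_arcFace h
  obtain ⟨hs', ht', -⟩ := side_sideIn h
  rw [hk, Face.side_injective f (hs'.trans hs.symm), Face.side_injective f (ht'.trans ht.symm)]

/-- An arc between distinct sides is not degenerate. [folklore] -/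
theorem arcKind_ne_degen {s t : Side} (hst : s ≠ t) : arcKind s t ≠ .degen := by
  cases s <;> cases t <;> simp [arcKind] at hst ⊢

namespace YBWalk

variable {D : Set Face} {a z : MidEdge} (γ : YBWalk D a z)

/-- The kinds of the arcs in a rhombus, as a `map` over the arcs drawn in it. [folklore] -/
theorem kindsIn_eq_map_filter (f : Face) :
    γ.kindsIn f = (γ.arcs.filter fun p => arcFace p = some f).map fun p => arcKind (sideIn p) (sideOut p) := by
  unfold YBWalk.kindsIn
  refine filterMap_eq_map_filter_of _ _ (fun p => arcFace p = some f) _ (fun p _ hp => ?_) (fun p _ hp => ?_)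
  · rw [if_pos hp, arcKindOf_eq_some hp]
  · rw [if_neg hp]

/-- **A walk whose triangle list is self-avoiding has nonzero weight at `π/3`**: a rhombus then
carries no arc, one arc (`u₁ = x_c`, `u₂ = v = x_c²`), or two corner arcs (`w₁ = x_c²`) — two arcs one
of which crosses the short diagonal would meet. Converse of `nodup_hvUpTo`.
[cite: GlazmanManolescu2019, §1 p. 3, Fig. 2] -/
theorem weight_ne_zero_of_nodup_hvInner (hnd : γ.hvInner.Nodup) : γ.weight (fun _ => Real.pi / 3) ≠ 0 := by
  rw [hvInner_eq_listTris] at hnd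
  have hxc : hexCriticalFugacity ≠ 0 := hexCriticalFugacity_pos_lt_one.1.ne'
  rw [YBWalk.weight, Finset.prod_ne_zero_iff]
  intro f _
  rw [kindsIn_eq_map_filter]
  set F := γ.arcs.filter fun p => arcFace p = some f with hF
  have hFsub : F.Sublist γ.arcs := List.filter_sublist
  have hFmem : ∀ p ∈ F, arcFace p = some f := fun p hp => by simpa [hF] using (List.mem_filter.1 hp).2
  have hFnd : F.Nodup := γ.nodup_arcs.sublist hFsub
  have hpw : F.Pairwise fun p q => List.Disjoint (arcTris p) (arcTris q) :=
    (pairwise_disjoint_arcTris_of_nodup hnd).sublist hFsub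
  -- an arc of `F` not cutting a corner meets every other arc of `F`
  have hcorner : ∀ p ∈ F, ∀ q ∈ F, p ≠ q → arcKind (sideIn p) (sideOut p) = .corner := by
    intro p hp q hq hpq
    have hd : List.Disjoint (arcTris p) (arcTris q) := hpw.forall hp hq hpq
    by_contra hk
    rw [arcKind_eq_corner_iff (side_sideIn (hFmem p hp)).2.2] at hk
    have m1 := mem_arcTris_of_tri_ne hk (sideIn q)
    rw [faceOf_eq (hFmem p hp), ← faceOf_eq (hFmem q hq)] at m1
    exact hd m1 (hv_sideIn_mem_arcTris q)
  rcases hF' : F with _ | ⟨p, _ | ⟨q, _ | ⟨r, F'⟩⟩⟩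
  · simp [localWeight]
  · have hk := arcKind_ne_degen (side_sideIn (hFmem p (by simp [hF']))).2.2
    revert hk
    simp only [List.map_cons, List.map_nil]
    generalize arcKind (sideIn p) (sideOut p) = κ
    cases κ <;> simp [localWeight, weightU1_pi_div_three, weightU2_pi_div_three, weightV_pi_div_three, hxc]
  · have hpq : p ≠ q := by
      intro h; subst h; rw [hF'] at hFnd; simp at hFnd
    have hp : p ∈ F := by simp [hF']
    have hq : q ∈ F := by simp [hF']
    simp only [List.map_cons, List.map_nil, hcorner p hp q hq hpq, hcorner q hq p hp (Ne.symm hpq)]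
    simp [localWeight, weightW1_pi_div_three, hxc]
  · exfalso
    rw [hF'] at hpw hFmem
    simp only [List.pairwise_cons, List.mem_cons, forall_eq_or_imp] at hpw
    obtain ⟨⟨dpq, dpr, -⟩, ⟨dqr, -⟩, -⟩ := hpw
    have ep := faceOf_eq (hFmem p (by simp))
    have eq' := faceOf_eq (hFmem q (by simp))
    have er := faceOf_eq (hFmem r (by simp))
    have mp := hv_sideIn_mem_arcTris p
    have mq := hv_sideIn_mem_arcTris q
    have mr := hv_sideIn_mem_arcTris r
    rw [ep] at mp; rw [eq'] at mq; rw [er] at mr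
    have key : ∀ {s t : Side} {P Q : MidEdge × MidEdge}, f.hv s ∈ arcTris P → f.hv t ∈ arcTris Q →
        List.Disjoint (arcTris P) (arcTris Q) → s.tri ≠ t.tri := by
      intro s t P Q hs ht hd hst
      rw [Face.hv_eq_hv_iff.2 ⟨rfl, hst⟩] at hs
      exact hd hs ht
    have h1 := key mp mq dpq
    have h2 := key mp mr dpr
    have h3 := key mq mr dqr
    revert h1 h2 h3
    cases (sideIn p).tri <;> cases (sideIn q).tri <;> cases (sideIn r).tri <;> decide

end YBWalk

/-- **Main statement of this file (registered sub-goal of `stub_gmHexDictionary`)**: a Yang–Baxter walk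
whose triangle list is self-avoiding has nonzero weight at `Θ ≡ π/3`. [cite: GlazmanManolescu2019, §1 p. 3, Fig. 2] -/
theorem weight_pi_div_three_ne_zero_of_nodup : ∀ {D : Set Face} {a z : MidEdge} (γ : YBWalk D a z), γ.hvInner.Nodup → γ.weight (fun _ => Real.pi / 3) ≠ 0 := by
  intro D a z γ hnd
  exact YBWalk.weight_ne_zero_of_nodup_hvInner γ hnd

end Summit.CriticalPhenomena.SAWScalingLimit.Cruxes.HexTransfer.YbRelay
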